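import Literature.NumberTheory.Automorphic.ArchTranslateExpStable
import Literature.NumberTheory.Automorphic.AutomorphicFormsGLContinuous
import Literature.NumberTheory.Automorphic.GLOneOfHeckeCharacterBJ
import Literature.NumberTheory.Automorphic.AutomorphicRepsGLSatakeProofs
import Literature.NumberTheory.Automorphic.AutomorphicTwistSatake
import Literature.NumberTheory.Automorphic.AdelicGroupDataGLOneProofs
import Literature.NumberTheory.Automorphic.Sweep1BaseChangeGLOne
import Literature.NumberTheory.Automorphic.TunnellOctahedralGlobal
import Literature.NumberTheory.GaloisRepresentations.HeckeCharacterRamificationProofs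
import Literature.NumberTheory.GaloisRepresentations.HeckeCharacterWeakApproximation
import HarnessLib

/-!
# The Hecke character of an automorphic representation of `GL₁(𝔸_K)` (Borel–Jacquet model),
# its differential, its Satake parameters, and weak base change read on characters

Topic `NumberTheory/Automorphic`; proof file (theorems only: no definition, no named fact, no
instance), fourth step (after `AutomorphicRepsGLOneLine`, `AutomorphicRepsGLOneArchParameter`,
`ArchTranslateExpStable`) of the rank-one case of the named fact
`ArthurClozel1989_strongLifting_archimedean` (`BaseChangeArchimedean`; Arthur–Clozel (1989), Ch. 3,
Thm. 5.1 with Ch. 1 §7). It completes the dictionary "automorphic representations of `GL(1)` =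
idèle class characters" (Gelbart 1975, §2.A and §6.A; Jacquet–Langlands 1970, §9; Borel–Jacquet
1979, 4.6) in the direction datum ↦ character — the converse of `GLOneOfHeckeCharacterBJ`
(`π_θ = ℂ·(θ∘det)/⊥`) — and reads Arthur–Clozel's relation (1.1) for `GL(1)` on characters.

Let `π = W / W'` be an automorphic representation of `GL₁(𝔸_K)` (Borel–Jacquet datum). Every
`X ∈ 𝔤 = 𝔤𝔩₁(K_∞)` acts on the line `W / W'` by a scalar `d(X)`
(`AutomorphicRepData.exists_lieDeriv_sub_smul_mem_glOne`) and every `g ∈ GL₁(𝔸_K)` by a scalar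
`c(g)` (`AutomorphicRepData.exists_rightTranslation_sub_smul_mem_glOne'`).

* `AutomorphicRepData.rightTranslation_ofArch_expMem_sub_exp_smul_mem_glOne` (private; an independent
  proof of the same statement, `AutomorphicRepData.rightTranslation_expMem_sub_exp_smul_mem_glOne`,
  is in `CuspidalCohomologyGLRankOneCharacter`) — **`c(exp tX) = e^{t d(X)}`**:
  choose `φ₀ ∈ W ∖ W'` and a functional `Λ` with `Λ(φ₀) = 1`, `Λ(W') = 0`
  (`exists_linearMap_eq_one_of_notMem`); then `c(exp tX) = Λ(r(exp tX) φ₀)`, and on the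
  finite-dimensional `Z(𝔤)`-orbit span of `φ₀` (stable under `X` and `r(exp tX)`,
  `exists_matrix_archTranslate_expMem_eq_sum`: `r(exp tX) bᵢ = ∑ⱼ (e^{tM})ᵢⱼ bⱼ`) this is a finite
  combination of entries of `e^{tM}`, differentiable with derivative `Λ(r(exp tX)(X φ₀)) = d(X) c`
  (`X φ₀ ≡ d(X) φ₀ mod W'`, and `W'` is `r(exp tX)`-stable); `c(1) = 1`, so `c(exp tX) = e^{t d(X)}`
  (`eq_exp_of_hasDerivAt_mul`).
* `AutomorphicRepData.exists_heckeCharacter_glOne` — **`π` has a Hecke character `χ_π`**: a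
  continuous character of `𝕀_K = 𝔸_Kˣ` trivial on `Kˣ` with `r(g) φ - χ_π(det g) φ ∈ W'` for all
  `g ∈ GL₁(𝔸_K)`, `φ ∈ W` (`c` is multiplicative by uniqueness of the scalar; trivial on `GL₁(K)`
  by left invariance of the forms and commutativity; trivial on the level of a form
  `φ₀ ∈ W ∖ W'`; continuous because its archimedean slices are `Y ↦ c(g₀) e^{d(Y)}` with `d` real
  linear, `continuousAt_of_continuousAt_archSlice` of `AutomorphicFormsGLContinuous`);
  `…heckeCharacter_glOne_unique` — it is unique; `…heckeCharacter_glOne_det_ofArch_expMem` —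
  **its differential is the infinitesimal character**, `χ_π(det exp(tX)) = e^{t d(X)}`.
* `AutomorphicRepData.exists_eq_singleton_of_hasSatakeParamAt_glOne`,
  `…hasSatakeParamAt_glOne_of_fixed`, `…eventually_hasSatakeParamAt_glOne` — **Satake parameters are
  the values at uniformizers**, `{χ_π(⟨ϖ⟩_v)}` (in rank one `T_{v,1} = r(t_{v,1})` on `K(𝔫)`-fixed
  forms, `heckeOperator_rightTranslation_glOne`, `det t_{v,1} = ⟨ϖ⟩_v`; fixed forms exist,
  `AutomorphicRepData.exists_principalCongruenceLevel_fixed`).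
* `AutomorphicRepData.heckeCharacter_eq_baseChange_of_isWeakBaseChangeLiftAE_glOne` — **if `Π` on
  `GL₁(𝔸_E)` is a weak base-change lift of `π` on `GL₁(𝔸_F)` (`IsWeakBaseChangeLiftAE`,
  Arthur–Clozel Ch. 3, Def. 1.1, (1.1)), `E/F` Galois, then `χ_Π = χ_π ∘ N_{E/F}`**
  (`HeckeCharacter.baseChange`): at almost every `w` relation (1.1) gives the Satake parameter
  `{χ_π(ϖ_v)^f} = {χ_Π(ϖ'')}` of `Π`, while `(χ_π ∘ N)(ϖ') = χ_π(ϖ_v)^f` for the image `ϖ'` of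
  `ϖ_v` (`HeckeCharacter.baseChange_localUnits`, `e(w|v) = 1` a.e.); two Hecke characters with the
  same values at almost all uniformizers are equal
  (`HeckeCharacter.ext_of_eventually_valueAtUniformizer_eq`, Cassels–Fröhlich VII Prop. 4.1). The
  Borel–Jacquet-model counterpart of
  `CuspidalAutomorphicRepGL.heckeCharacter_eq_baseChange_of_isWeakBaseChangeLift` (`L²` model),
  valid for every automorphic representation datum.

## References

* S. Gelbart, *Automorphic forms on adele groups*, Ann. of Math. Stud. 83 (1975), §2.A, §6.A
  [Gelbart1975].
* A. Borel, H. Jacquet, Corvallis (1979), Part 1, §4.6, 5.7 [BorelJacquet1979].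
* A. Borel, *Automorphic forms on `SL₂(ℝ)`* (1997), 8.6 [Borel1997].
* J. Tate, *Fourier analysis in number fields and Hecke's zeta-functions*, in Cassels–Fröhlich (1967),
  Ch. XV, §2.3, §4.1; J. Tate, *Global class field theory*, ibid. Ch. VII §4 Prop. 4.1
  [TateThesis1967] [CasselsFrohlichANT1967].
* J. Arthur, L. Clozel, Ann. of Math. Stud. 120 (1989), Ch. 1 §7; Ch. 3 §1 Def. 1.1 and (1.1), §4,
  Thm. 5.1 [ArthurClozelAMS120].
-/

noncomputable section

open scoped MatrixGroups Matrix Classical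
open NumberField NumberField.mixedEmbedding IsDedekindDomain NormedSpace Filter
open _root_.Topology

namespace Literature.NumberTheory.Automorphic

/-! ### Two lemmas of linear algebra and calculus -/

section Lemmas

/-- **The scalar ODE `F' = μ F`, `F(0) = 1`, is solved by `e^{μt}`** (`t ↦ e^{-μt} F(t)` has
derivative zero). [folklore] -/
theorem eq_exp_of_hasDerivAt_mul {F : ℝ → ℂ} {μ : ℂ} (hF : ∀ t, HasDerivAt F (μ * F t) t)
    (h0 : F 0 = 1) (t : ℝ) : F t = Complex.exp (μ * t) := by
  set w : ℝ → ℂ := fun s => Complex.exp (-(μ * s)) * F s with hw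
  have hw' : ∀ s : ℝ, HasDerivAt w 0 s := by
    intro s
    have he : HasDerivAt (fun s : ℝ => Complex.exp (-(μ * s))) (Complex.exp (-(μ * s)) * (-μ)) s := by
      have h0 := ((hasDerivAt_id s).ofReal_comp).const_mul (-μ)
      have hf : (fun y : ℝ => -μ * ((id y : ℝ) : ℂ)) = fun s : ℝ => -(μ * (s : ℂ)) := by
        funext y; rw [id, neg_mul]
      rw [hf] at h0
      have h1 : HasDerivAt (fun s : ℝ => -(μ * (s : ℂ))) (-μ) s :=
        h0.congr_deriv (by rw [Complex.ofReal_one, mul_one])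
      exact h1.cexp
    refine (he.mul (hF s)).congr_deriv ?_
    ring
  have hconst := is_const_of_deriv_eq_zero (fun s => (hw' s).differentiableAt)
    (fun s => (hw' s).deriv) t 0
  simp only [hw, h0, mul_zero, neg_zero, Complex.exp_zero, mul_one, Complex.ofReal_zero] at hconst
  have hexp : Complex.exp (μ * t) * Complex.exp (-(μ * t)) = 1 := by
    rw [← Complex.exp_add, add_neg_cancel, Complex.exp_zero]
  calc F t = Complex.exp (μ * t) * (Complex.exp (-(μ * t)) * F t) := by rw [← mul_assoc, hexp, one_mul]
    _ = Complex.exp (μ * t) := by rw [hconst, mul_one]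

/-- **A linear functional separating a vector from a subspace**: if `φ₀ ∉ W'` there is a linear
functional `Λ` with `Λ φ₀ = 1` and `Λ = 0` on `W'` (complements exist over a field). [folklore] -/
theorem exists_linearMap_eq_one_of_notMem {F : Type*} [AddCommGroup F] [Module ℂ F]
    (W' : Submodule ℂ F) {φ₀ : F} (hφ₀ : φ₀ ∉ W') :
    ∃ Λ : F →ₗ[ℂ] ℂ, Λ φ₀ = 1 ∧ ∀ w ∈ W', Λ w = 0 := by
  have h0 : φ₀ ≠ 0 := fun h => hφ₀ (h ▸ W'.zero_mem)
  set L : Submodule ℂ F := ℂ ∙ φ₀ with hL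
  obtain ⟨C, hC⟩ := (W' ⊔ L).exists_isCompl
  set D : Submodule ℂ F := W' ⊔ C with hD
  have hLD : IsCompl L D := by
    refine ⟨Submodule.disjoint_def.2 fun x hxL hxD => ?_, codisjoint_iff.2 ?_⟩
    · obtain ⟨w, hw, c, hc, rfl⟩ := Submodule.mem_sup.1 hxD
      have hc' : c ∈ W' ⊔ L := by
        have : c = (w + c) - w := by abel
        rw [this]
        exact Submodule.sub_mem _ (Submodule.mem_sup_right hxL) (Submodule.mem_sup_left hw)
      have hc0 : c = 0 := Submodule.disjoint_def.1 hC.disjoint c hc' hc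
      subst hc0
      rw [add_zero] at hxL ⊢
      obtain ⟨a, rfl⟩ := Submodule.mem_span_singleton.1 hxL
      by_cases ha : a = 0
      · rw [ha, zero_smul]
      · exact absurd (by simpa [ha] using W'.smul_mem a⁻¹ hw) hφ₀
    · rw [hD, ← sup_assoc, sup_comm L W', hC.sup_eq_top]
  refine ⟨(LinearEquiv.toSpanNonzeroSingleton ℂ F φ₀ h0).symm.toLinearMap ∘ₗ
      Submodule.projectionOnto L D hLD, ?_, fun w hw => ?_⟩
  · have h1 : Submodule.projectionOnto L D hLD φ₀ =
        ⟨φ₀, Submodule.mem_span_singleton_self φ₀⟩ :=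
      Submodule.projectionOnto_apply_left hLD ⟨φ₀, Submodule.mem_span_singleton_self φ₀⟩
    rw [LinearMap.comp_apply, h1, LinearEquiv.coe_toLinearMap,
      ← LinearEquiv.toSpanNonzeroSingleton_one ℂ F φ₀ h0, LinearEquiv.symm_apply_apply]
  · have hwD : w ∈ D := Submodule.mem_sup_left hw
    have h1 : Submodule.projectionOnto L D hLD w = 0 :=
      Submodule.projectionOnto_apply_right hLD ⟨w, hwD⟩
    rw [LinearMap.comp_apply, h1, map_zero]

end Lemmas

/-! ### Lie derivatives of finite linear combinations of smooth functions -/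

section ArchCalc

variable {A : Type*} [NormedCommRing A] [NormedAlgebra ℝ A] [NormedAlgebra ℚ A] [CompleteSpace A]
  [StarRing A] {N : Type*} [Fintype N] [DecidableEq N] {H : RealMatrixGroup A N}
  {G : Type*} [Group G] (ι : H.carrier →* G)

/-- The Lie derivative of a finite linear combination of smooth functions. [folklore] -/
theorem lieDeriv_sum_smul_of_isArchSmooth (X : H.lie) {m : ℕ} (c : Fin m → ℂ) (ψ : Fin m → G → ℂ)
    (hψ : ∀ i, IsArchSmooth ι (ψ i)) :
    lieDeriv ι X (∑ i, c i • ψ i) = ∑ i, c i • lieDeriv ι X (ψ i) := by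
  classical
  have key : ∀ s : Finset (Fin m),
      lieDeriv ι X (∑ i ∈ s, c i • ψ i) = ∑ i ∈ s, c i • lieDeriv ι X (ψ i) := by
    intro s
    induction s using Finset.induction_on with
    | empty => simp [lieDeriv_zero_right]
    | insert a s ha ih =>
      rw [Finset.sum_insert ha, Finset.sum_insert ha,
        IsArchSmooth.lieDeriv_add ι X ((hψ a).smul ι (c a))
          ((archSmooth ι).sum_mem fun i _ => (hψ i).smul ι (c i)),
        lieDeriv_smul, ih]
  exact key Finset.univ

end ArchCalc

/-! ### The scalar of `r(exp tX)` on an automorphic representation of `GL₁(𝔸_K)` -/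

section GLOne

variable {K : Type} [Field K] [NumberField K] {hcpt : isCompact_glFiniteIntegralLevel 1 K}

/-- A double sum rearrangement: `∑ₖ Mᵢₖ ∑ⱼ Eₖⱼ Lⱼ = ∑ⱼ (M E)ᵢⱼ Lⱼ`. [folklore] -/
theorem sum_mul_sum_mul_eq_sum_mul_apply {m : ℕ} (M E : Matrix (Fin m) (Fin m) ℂ) (L : Fin m → ℂ)
    (i : Fin m) : (∑ k, M i k * ∑ j, E k j * L j) = ∑ j, (M * E) i j * L j := by
  simp only [Finset.mul_sum, Matrix.mul_apply, Finset.sum_mul]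
  rw [Finset.sum_comm]
  refine Finset.sum_congr rfl fun j _ => Finset.sum_congr rfl fun k _ => ?_
  ring

set_option maxHeartbeats 400000 in
/-- **The one-parameter subgroup `exp(tX)` of `GL₁(K_∞)` acts on `W / W'` by `e^{t d(X)}`**, where
`d(X)` is the scalar by which the Lie derivative along `X` acts on `W / W'`: for an automorphic
representation `π = W / W'` of `GL₁(𝔸_K)`, if `X φ - d(X) φ ∈ W'` for all `φ ∈ W`, then
`r(exp tX) φ - e^{t d(X)} φ ∈ W'` for all `φ ∈ W` and `t ∈ ℝ`. (The scalar `f(t)` of `r(exp tX)`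
is `Λ(r(exp tX) φ₀)` for `φ₀ ∈ W ∖ W'` and `Λ` a functional with `Λ φ₀ = 1`, `Λ(W') = 0`; on the
`Z(𝔤)`-orbit span of `φ₀` the translates are matrix exponentials in a basis, so `f` is
differentiable with `f' = d(X) f`, `f(0) = 1`.) Gelbart 1975, §2.A; Borel–Jacquet 1979, 4.6, 5.7;
Borel 1997, 8.6. (Private: the tree's `CuspidalCohomologyGLRankOneCharacter` proves the same
statement, `AutomorphicRepData.rightTranslation_expMem_sub_exp_smul_mem_glOne`, by a different
route — generalised eigenvectors and a Jordan chain of ODEs; this file keeps its own short proof to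
stay independent of that cohomological import.)
[cite: Gelbart1975, §2.A] -/
private theorem AutomorphicRepData.rightTranslation_ofArch_expMem_sub_exp_smul_mem_glOne
    (π : AutomorphicRepData (AutomorphyDatum.gl 1 K hcpt)) (X : (AutomorphyDatum.gl 1 K hcpt).arch.lie)
    {dX : ℂ} (hdX : ∀ φ ∈ π.W, lieDeriv (AutomorphyDatum.gl 1 K hcpt).ofArch X φ - dX • φ ∈ π.W')
    (t : ℝ) {φ : (AdelicGroupData.gl 1 K).Adelic → ℂ} (hφ : φ ∈ π.W) :
    rightTranslation (AdelicGroupData.gl 1 K) ((AutomorphyDatum.gl 1 K hcpt).ofArch ((AutomorphyDatum.gl 1 K hcpt).arch.expMem (t • X))) φ -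
      Complex.exp (t * dX) • φ ∈ π.W' := by
  -- the scalar `f s` of `r(exp sX)`
  have hf0 := fun s : ℝ => π.exists_rightTranslation_sub_smul_mem_glOne' ((AutomorphyDatum.gl 1 K hcpt).ofArch ((AutomorphyDatum.gl 1 K hcpt).arch.expMem (s • X)))
  choose f hf using hf0
  -- `φ₀ ∈ W ∖ W'` and a separating functional
  obtain ⟨φ₀, hφ₀W, hφ₀W'⟩ := SetLike.exists_of_lt π.lt
  obtain ⟨Λ, hΛ₀, hΛW'⟩ := exists_linearMap_eq_one_of_notMem π.W' hφ₀W'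
  have hΛscalar : ∀ (T : ((AdelicGroupData.gl 1 K).Adelic → ℂ) → ((AdelicGroupData.gl 1 K).Adelic → ℂ))
      (c : ℂ), (∀ ψ ∈ π.W, T ψ - c • ψ ∈ π.W') → ∀ ψ ∈ π.W, Λ (T ψ) = c * Λ ψ := by
    intro T c hT ψ hψ
    have h := hΛW' _ (hT ψ hψ)
    rw [map_sub, map_smul, smul_eq_mul, sub_eq_zero] at h
    exact h
  -- `F s = Λ (r(exp sX) φ₀) = f s`
  have hFf : ∀ s : ℝ, Λ (rightTranslation (AdelicGroupData.gl 1 K) ((AutomorphyDatum.gl 1 K hcpt).ofArch ((AutomorphyDatum.gl 1 K hcpt).arch.expMem (s • X))) φ₀) = f s := fun s => by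
    rw [hΛscalar _ _ (hf s) φ₀ hφ₀W, hΛ₀, mul_one]
  -- the finite-dimensional `Z(𝔤)`-orbit span of `φ₀`
  have hφ₀form : IsAutomorphicForm (AutomorphyDatum.gl 1 K hcpt) φ₀ :=
    isAutomorphicForm_of_mem_automorphicForms_gl (π.stable.le_automorphicForms hφ₀W)
  have hφ₀s : IsArchSmooth (AutomorphyDatum.gl 1 K hcpt).ofArch φ₀ := hφ₀form.archSmooth
  generalize hV : zOrbitSpan (AutomorphyDatum.gl 1 K hcpt).ofArch φ₀ = V
  have hφ₀V : φ₀ ∈ V := hV ▸ mem_zOrbitSpan_self _ φ₀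
  haveI : FiniteDimensional ℂ V := hV ▸ hφ₀form.zFinite
  have hVs : ∀ ψ ∈ V, IsArchSmooth (AutomorphyDatum.gl 1 K hcpt).ofArch ψ := fun ψ hψ =>
    isArchSmooth_of_mem_zOrbitSpan _ hφ₀s (hV ▸ hψ)
  have hVX : ∀ ψ ∈ V, lieDeriv (AutomorphyDatum.gl 1 K hcpt).ofArch X ψ ∈ V := fun ψ hψ => by
    rw [← hV] at hψ ⊢
    exact lieDeriv_mem_zOrbitSpan_of_forall_lie_eq_zero _ (glOne_lie_eq_zero X) hφ₀s hψ
  obtain ⟨M, hMX, hME⟩ := exists_matrix_archTranslate_expMem_eq_sum (AutomorphyDatum.gl 1 K hcpt).ofArch V hVs X hVX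
  obtain ⟨b, hb⟩ : ∃ b : Module.Basis (Fin (Module.finrank ℂ V)) ℂ V, b = Module.finBasis ℂ V := ⟨_, rfl⟩
  rw [← hb] at hMX hME
  obtain ⟨a, ha⟩ : ∃ a : Fin (Module.finrank ℂ V) → ℂ, a = fun i => b.repr ⟨φ₀, hφ₀V⟩ i := ⟨_, rfl⟩
  have hφ₀sum : φ₀ = ∑ i, a i • (b i : (AdelicGroupData.gl 1 K).Adelic → ℂ) := by
    have h := congrArg (fun v : V => (v : (AdelicGroupData.gl 1 K).Adelic → ℂ)) (b.sum_repr ⟨φ₀, hφ₀V⟩)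
    simp only [AddSubmonoidClass.coe_finsetSum, SetLike.val_smul] at h
    rw [ha]
    exact h.symm
  -- translates of the basis: `r(exp sX) bᵢ = ∑ⱼ (e^{sM})ᵢⱼ bⱼ`
  have hMEr : ∀ (s : ℝ) (i : Fin (Module.finrank ℂ V)),
      rightTranslation (AdelicGroupData.gl 1 K) ((AutomorphyDatum.gl 1 K hcpt).ofArch ((AutomorphyDatum.gl 1 K hcpt).arch.expMem (s • X))) (b i : (AdelicGroupData.gl 1 K).Adelic → ℂ) =
        ∑ j, exp (s • M) i j • (b j : (AdelicGroupData.gl 1 K).Adelic → ℂ) := fun s i => hME s i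
  have htrans : ∀ s : ℝ, rightTranslation (AdelicGroupData.gl 1 K) ((AutomorphyDatum.gl 1 K hcpt).ofArch ((AutomorphyDatum.gl 1 K hcpt).arch.expMem (s • X))) φ₀ =
      ∑ i, a i • ∑ j, exp (s • M) i j • (b j : (AdelicGroupData.gl 1 K).Adelic → ℂ) := by
    intro s
    conv_lhs => rw [hφ₀sum]
    rw [map_sum]
    refine Finset.sum_congr rfl fun i _ => ?_
    rw [map_smul, hMEr s i]
  obtain ⟨Lb, hLb⟩ : ∃ Lb : Fin (Module.finrank ℂ V) → ℂ,
      ∀ j, Lb j = Λ (b j : (AdelicGroupData.gl 1 K).Adelic → ℂ) := ⟨_, fun j => rfl⟩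
  have hFsum : ∀ s : ℝ, f s = ∑ i, a i * ∑ j, exp (s • M) i j * Lb j := by
    intro s
    rw [← hFf s, htrans s, map_sum]
    refine Finset.sum_congr rfl fun i _ => ?_
    rw [map_smul, map_sum, smul_eq_mul]
    congr 1
    refine Finset.sum_congr rfl fun j _ => ?_
    rw [map_smul, smul_eq_mul, hLb]
  -- `f` is differentiable with `f' = ∑ᵢ aᵢ ∑ⱼ (e^{sM} M)ᵢⱼ Λ(bⱼ)`
  have hfderiv : ∀ s : ℝ, HasDerivAt f (∑ i, a i * ∑ j, (exp (s • M) * M) i j * Lb j) s := by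
    intro s
    have hinner : ∀ i, HasDerivAt (fun s : ℝ => ∑ j, exp (s • M) i j * Lb j)
        (∑ j, (exp (s • M) * M) i j * Lb j) s := by
      intro i
      have h := HasDerivAt.sum (u := Finset.univ) (A := fun j (s : ℝ) => exp (s • M) i j * Lb j)
        (A' := fun j => (exp (s • M) * M) i j * Lb j) (x := s)
        (fun j _ => (hasDerivAt_exp_smul_apply M s i j).mul_const (Lb j))
      have hfun : (fun s : ℝ => ∑ j, exp (s • M) i j * Lb j) =
          ∑ j ∈ Finset.univ, (fun j (s : ℝ) => exp (s • M) i j * Lb j) j := by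
        funext s'
        rw [Finset.sum_apply]
      rw [hfun]
      exact h
    have h := HasDerivAt.sum (u := Finset.univ)
      (A := fun i (s : ℝ) => a i * ∑ j, exp (s • M) i j * Lb j)
      (A' := fun i => a i * ∑ j, (exp (s • M) * M) i j * Lb j) (x := s)
      (fun i _ => (hinner i).const_mul (a i))
    have hfeq : f = ∑ i ∈ Finset.univ, (fun i (s : ℝ) => a i * ∑ j, exp (s • M) i j * Lb j) i := by
      funext s
      rw [Finset.sum_apply]
      exact hFsum s
    rw [hfeq]
    exact h
  -- the derivative is `d(X) f`: compute `Λ (r(exp sX) (X φ₀))` in two ways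
  have hXφ₀ : lieDeriv (AutomorphyDatum.gl 1 K hcpt).ofArch X φ₀ =
      ∑ i, a i • ∑ k, M i k • (b k : (AdelicGroupData.gl 1 K).Adelic → ℂ) := by
    conv_lhs => rw [hφ₀sum]
    rw [lieDeriv_sum_smul_of_isArchSmooth (AutomorphyDatum.gl 1 K hcpt).ofArch X a _ (fun i => hVs _ (b i).2)]
    refine Finset.sum_congr rfl fun i _ => ?_
    rw [hMX i]
  have hderiv_eq : ∀ s : ℝ, (∑ i, a i * ∑ j, (exp (s • M) * M) i j * Lb j) = dX * f s := by
    intro s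
    -- way A: `X φ₀ = dX φ₀ + w'`, `w' ∈ W'`, and `W'` is `r(exp sX)`-stable
    have hw' : lieDeriv (AutomorphyDatum.gl 1 K hcpt).ofArch X φ₀ - dX • φ₀ ∈ π.W' := hdX φ₀ hφ₀W
    have hA : Λ (rightTranslation (AdelicGroupData.gl 1 K) ((AutomorphyDatum.gl 1 K hcpt).ofArch ((AutomorphyDatum.gl 1 K hcpt).arch.expMem (s • X))) (lieDeriv (AutomorphyDatum.gl 1 K hcpt).ofArch X φ₀)) = dX * f s := by
      -- `r(h)` is linear (definitionally: `(r(h) ψ)(g) = ψ (g h)`)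
      have hlin : rightTranslation (AdelicGroupData.gl 1 K) ((AutomorphyDatum.gl 1 K hcpt).ofArch ((AutomorphyDatum.gl 1 K hcpt).arch.expMem (s • X))) (lieDeriv (AutomorphyDatum.gl 1 K hcpt).ofArch X φ₀ - dX • φ₀) =
          rightTranslation (AdelicGroupData.gl 1 K) ((AutomorphyDatum.gl 1 K hcpt).ofArch ((AutomorphyDatum.gl 1 K hcpt).arch.expMem (s • X))) (lieDeriv (AutomorphyDatum.gl 1 K hcpt).ofArch X φ₀) -
            dX • rightTranslation (AdelicGroupData.gl 1 K) ((AutomorphyDatum.gl 1 K hcpt).ofArch ((AutomorphyDatum.gl 1 K hcpt).arch.expMem (s • X))) φ₀ :=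
        funext fun _ => rfl
      have e := congrArg Λ hlin
      rw [hΛW' _ (π.stable'.rightTranslation_ofArch_expMem_mem_glOne X s hw'), map_sub, map_smul,
        smul_eq_mul, hFf s] at e
      exact (sub_eq_zero.1 e.symm)
    -- way B: expand in the basis
    have hB : Λ (rightTranslation (AdelicGroupData.gl 1 K) ((AutomorphyDatum.gl 1 K hcpt).ofArch ((AutomorphyDatum.gl 1 K hcpt).arch.expMem (s • X))) (lieDeriv (AutomorphyDatum.gl 1 K hcpt).ofArch X φ₀)) =
        ∑ i, a i * ∑ j, (M * exp (s • M)) i j * Lb j := by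
      rw [hXφ₀, map_sum, map_sum]
      refine Finset.sum_congr rfl fun i _ => ?_
      rw [map_smul, map_smul, smul_eq_mul, map_sum, map_sum]
      congr 1
      rw [← sum_mul_sum_mul_eq_sum_mul_apply]
      refine Finset.sum_congr rfl fun k _ => ?_
      rw [map_smul, map_smul, smul_eq_mul, hMEr s k, map_sum]
      congr 1
      refine Finset.sum_congr rfl fun j _ => ?_
      rw [map_smul, smul_eq_mul, hLb]
    rw [← hA, hB]
    simp only [mul_exp_smul_comm]
  have hf' : ∀ s : ℝ, HasDerivAt f (dX * f s) s := fun s => (hfderiv s).congr_deriv (hderiv_eq s)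
  have hf0' : f 0 = 1 := by
    have h00 := hFf 0
    have hone : (AutomorphyDatum.gl 1 K hcpt).ofArch ((AutomorphyDatum.gl 1 K hcpt).arch.expMem ((0 : ℝ) • X)) = 1 := by
      rw [zero_smul, RealMatrixGroup.expMem_zero', map_one]
    have hr1 : rightTranslation (AdelicGroupData.gl 1 K) (1 : (AdelicGroupData.gl 1 K).Adelic) φ₀ = φ₀ :=
      funext fun g => by rw [rightTranslation_apply, mul_one]
    rw [hone, hr1, hΛ₀] at h00
    exact h00.symm
  have hfexp : f t = Complex.exp (dX * t) := eq_exp_of_hasDerivAt_mul hf' hf0' t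
  -- conclusion
  have := hf t φ hφ
  rw [hfexp, mul_comm dX (t : ℂ)] at this
  exact this

end GLOne


open Literature.NumberTheory.GaloisRepresentations (HeckeCharacter ideleGroup localUnits principalIdeles)

section GLOneHecke

variable {K : Type} [Field K] [NumberField K] {hcpt : isCompact_glFiniteIntegralLevel 1 K}

/-- `det (scalar x) = x` on `GL₁`. [folklore] -/
theorem det_generalLinearGroup_scalar_fin_one {R : Type*} [CommRing R] (x : Rˣ) :
    Matrix.GeneralLinearGroup.det (Matrix.GeneralLinearGroup.scalar (Fin 1) x) = x :=
  Units.ext (by simp)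

/-- **Uniqueness of the Hecke character of `π`**: a Hecke character `χ` with
`r(g) φ - χ(det g) φ ∈ W'` for all `g`, `φ ∈ W` is unique (evaluate at the scalar `g = x`).
Gelbart 1975, §2.A. [folklore] -/
theorem AutomorphicRepData.heckeCharacter_glOne_unique (π : AutomorphicRepData (AutomorphyDatum.gl 1 K hcpt))
    {χ₁ χ₂ : HeckeCharacter K}
    (h₁ : ∀ (g : (AdelicGroupData.gl 1 K).Adelic), ∀ φ ∈ π.W,
      rightTranslation (AdelicGroupData.gl 1 K) g φ -
        ((χ₁ (Matrix.GeneralLinearGroup.det g) : ℂˣ) : ℂ) • φ ∈ π.W')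
    (h₂ : ∀ (g : (AdelicGroupData.gl 1 K).Adelic), ∀ φ ∈ π.W,
      rightTranslation (AdelicGroupData.gl 1 K) g φ -
        ((χ₂ (Matrix.GeneralLinearGroup.det g) : ℂˣ) : ℂ) • φ ∈ π.W') :
    χ₁ = χ₂ := by
  refine HeckeCharacter.ext fun x => Units.ext ?_
  have e₁ := h₁ (show (AdelicGroupData.gl 1 K).Adelic from Matrix.GeneralLinearGroup.scalar (Fin 1) x)
  have e₂ := h₂ (show (AdelicGroupData.gl 1 K).Adelic from Matrix.GeneralLinearGroup.scalar (Fin 1) x)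
  have hdet : Matrix.GeneralLinearGroup.det
      (show (AdelicGroupData.gl 1 K).Adelic from Matrix.GeneralLinearGroup.scalar (Fin 1) x) = x :=
    det_generalLinearGroup_scalar_fin_one x
  rw [hdet] at e₁ e₂
  exact π.sub_smul_mem_unique e₁ e₂

/-- **The Hecke character of an automorphic representation of `GL₁(𝔸_K)`.** For every
automorphic representation `π = W / W'` of `GL₁(𝔸_K)` in the sense of Borel–Jacquet there is a
Hecke character `χ_π` of `K` (continuous character of `𝕀_K` trivial on `Kˣ`) such that every
`g ∈ GL₁(𝔸_K)` acts on `W / W'` by `χ_π(det g)`: `r(g) φ - χ_π(det g) φ ∈ W'` for all `φ ∈ W`.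
(The scalar `c(g)` of `r(g)` is multiplicative; `c = 1` on `GL₁(K)` by left invariance of the forms
and commutativity, and on the level of a form `φ₀ ∈ W ∖ W'`; `c` is continuous because its
archimedean slices are `Y ↦ c(g₀) e^{d(Y)}` with `d` the infinitesimal character,
`rightTranslation_ofArch_expMem_sub_exp_smul_mem_glOne`, `continuousAt_of_continuousAt_archSlice`.)
Gelbart 1975, §2.A and §6.A (automorphic forms on `GL(1)` are Grössencharacters);
Jacquet–Langlands 1970, §9; Borel–Jacquet 1979, 4.6. [cite: Gelbart1975, §2.A] -/
theorem AutomorphicRepData.exists_heckeCharacter_glOne (π : AutomorphicRepData (AutomorphyDatum.gl 1 K hcpt)) :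
    ∃ χ : HeckeCharacter K, ∀ (g : (AdelicGroupData.gl 1 K).Adelic), ∀ φ ∈ π.W,
      rightTranslation (AdelicGroupData.gl 1 K) g φ -
        ((χ (Matrix.GeneralLinearGroup.det g) : ℂˣ) : ℂ) • φ ∈ π.W' := by
  -- the scalars `c g`
  choose c hc using π.exists_rightTranslation_sub_smul_mem_glOne'
  obtain ⟨φ₀, hφ₀W, hφ₀W'⟩ := SetLike.exists_of_lt π.lt
  have huniq : ∀ (g : (AdelicGroupData.gl 1 K).Adelic) (a : ℂ),
      rightTranslation (AdelicGroupData.gl 1 K) g φ₀ - a • φ₀ ∈ π.W' → a = c g :=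
    fun g a ha => eq_of_sub_smul_mem_of_not_mem ha (hc g φ₀ hφ₀W) hφ₀W'
  have hc1 : c 1 = 1 := (huniq 1 1 (by
    rw [map_one, Module.End.one_apply, one_smul, sub_self]; exact π.W'.zero_mem)).symm
  have hcmul : ∀ g h, c (g * h) = c g * c h := by
    intro g h
    refine (huniq (g * h) (c g * c h) ?_).symm
    have hA := hc g _ (π.stable.rightTranslation_mem_glOne h hφ₀W)
    have hB := π.W'.smul_mem (c g) (hc h φ₀ hφ₀W)
    have := π.W'.add_mem hA hB
    rw [map_mul, Module.End.mul_apply]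
    convert this using 1
    rw [smul_sub, smul_smul]
    abel
  have hc0 : ∀ g, c g ≠ 0 := fun g h0 => by
    have := hcmul g g⁻¹
    rw [mul_inv_cancel, hc1, h0, zero_mul] at this
    exact one_ne_zero this
  -- `c` is trivial on the level of `φ₀` and on `GL₁(K)`
  have hφ₀form : IsAutomorphicForm (AutomorphyDatum.gl 1 K hcpt) φ₀ :=
    isAutomorphicForm_of_mem_automorphicForms_gl (π.stable.le_automorphicForms hφ₀W)
  have hfixc : ∀ u : (AdelicGroupData.gl 1 K).Adelic,
      (∀ g, φ₀ (g * u) = φ₀ g) → c u = 1 := by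
    intro u hu
    refine (huniq u 1 ?_).symm
    have : rightTranslation (AdelicGroupData.gl 1 K) u φ₀ = φ₀ := funext fun g => hu g
    rw [this, one_smul, sub_self]
    exact π.W'.zero_mem
  obtain ⟨U, hU, hφ₀U⟩ := hφ₀form.exists_level
  obtain ⟨U₀, hU₀o, -, rfl⟩ := mem_finiteLevelsGL_iff.1 hU
  have hcU : ∀ u ∈ U₀.map (GLn.ofFinite 1 K), c u = 1 := fun u hu => hfixc u (hφ₀U u hu)
  have hcK : ∀ γ ∈ (AdelicGroupData.gl 1 K).arithmeticSubgroup, c γ = 1 := by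
    intro γ hγ
    refine hfixc γ fun g => ?_
    rw [show g * γ = γ * g from AdelicGroupData.gl_one_mul_comm (K := K) g γ]
    exact hφ₀form.leftInvariant γ hγ g
  -- the infinitesimal character `d`, a real linear form
  choose d₀ hd₀ using π.exists_lieDeriv_sub_smul_mem_glOne
  have hWsmooth : ∀ φ ∈ π.W, IsArchSmooth (AutomorphyDatum.gl 1 K hcpt).ofArch φ := fun φ h => π.stable.isArchSmooth h
  have hduniq : ∀ (X : (AutomorphyDatum.gl 1 K hcpt).arch.lie) (a : ℂ), lieDeriv (AutomorphyDatum.gl 1 K hcpt).ofArch X φ₀ - a • φ₀ ∈ π.W' → a = d₀ X :=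
    fun X a ha => eq_of_sub_smul_mem_of_not_mem ha (hd₀ X φ₀ hφ₀W) hφ₀W'
  let d : (AutomorphyDatum.gl 1 K hcpt).arch.lie →ₗ[ℝ] ℂ :=
    { toFun := d₀
      map_add' := fun X Y => by
        refine (hduniq (X + Y) (d₀ X + d₀ Y) ?_).symm
        rw [IsArchSmooth.lieDeriv_add_left _ (hWsmooth φ₀ hφ₀W) X Y, add_smul]
        convert π.W'.add_mem (hd₀ X φ₀ hφ₀W) (hd₀ Y φ₀ hφ₀W) using 1
        abel
      map_smul' := fun r X => by
        refine (hduniq (r • X) (r • d₀ X) ?_).symm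
        rw [IsArchSmooth.lieDeriv_smul_left _ (hWsmooth φ₀ hφ₀W) r X]
        have h1 := π.W'.smul_mem (r : ℂ) (hd₀ X φ₀ hφ₀W)
        convert h1 using 1
        funext g
        simp only [Pi.sub_apply, Pi.smul_apply, smul_eq_mul, Complex.real_smul]
        ring }
  have hd : ∀ X, d X = d₀ X := fun X => rfl
  -- `c (exp X) = e^{d X}`
  have hcexp : ∀ X : (AutomorphyDatum.gl 1 K hcpt).arch.lie, c ((AutomorphyDatum.gl 1 K hcpt).ofArch ((AutomorphyDatum.gl 1 K hcpt).arch.expMem X)) = Complex.exp (d X) := by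
    intro X
    refine (huniq _ _ ?_).symm
    have h := π.rightTranslation_ofArch_expMem_sub_exp_smul_mem_glOne X (hd₀ X) 1 hφ₀W
    rwa [one_smul, Complex.ofReal_one, one_mul] at h
  -- continuity of `c`
  have hccont : Continuous c := by
    refine continuous_iff_continuousAt.2 fun g₀ => ?_
    refine continuousAt_of_continuousAt_archSlice (n := 1) (K := K) hU₀o (fun u hu g => ?_) g₀ ?_
    · change c (g * u) = c g
      have h := hcmul g u
      rw [hcU u hu, mul_one] at h
      exact h
    · -- the slice `Y ↦ c g₀ * e^{d Y}`
      have hslice : (fun Y : Matrix (Fin 1) (Fin 1) (mixedSpace K) =>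
          c ((show GL (Fin 1) (AdeleRing (𝓞 K) K) from g₀) * GLn.ofInfinite 1 K (expGL Y))) =
          fun Y => c g₀ * Complex.exp (d ⟨Y, trivial⟩) := by
        funext Y
        have h1 := hcmul g₀ (GLn.ofInfinite 1 K (expGL Y))
        refine h1.trans ?_
        congr 1
        exact hcexp ⟨Y, trivial⟩
      rw [hslice]
      refine (continuous_const.mul (Complex.continuous_exp.comp ?_)).continuousAt
      have hlin : Continuous (d ∘ₗ
          { toFun := fun Y : Matrix (Fin 1) (Fin 1) (mixedSpace K) =>
              (⟨Y, trivial⟩ : (AutomorphyDatum.gl 1 K hcpt).arch.lie)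
            map_add' := fun _ _ => rfl
            map_smul' := fun _ _ => rfl } : Matrix (Fin 1) (Fin 1) (mixedSpace K) →ₗ[ℝ] ℂ) :=
        LinearMap.continuous_of_finiteDimensional _
      exact hlin
  -- the character on ideles
  let χ₀ : (AdelicGroupData.gl 1 K).Adelic →* ℂˣ :=
    { toFun := fun g => Units.mk0 (c g) (hc0 g)
      map_one' := Units.ext hc1
      map_mul' := fun g h => Units.ext (hcmul g h) }
  let ψ : ideleGroup K →* ℂˣ :=
    χ₀.comp (Matrix.GeneralLinearGroup.scalar (Fin 1) :
      (AdeleRing (𝓞 K) K)ˣ →* GL (Fin 1) (AdeleRing (𝓞 K) K))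
  have hψcont : Continuous ψ := by
    have h1 : Continuous fun x : ideleGroup K =>
        ((ψ x : ℂˣ) : ℂ) :=
      hccont.comp (continuous_generalLinearGroup_scalar (R := AdeleRing (𝓞 K) K) (Fin 1))
    refine Units.continuous_iff.2 ⟨h1, ?_⟩
    have h2 : Continuous fun x : ideleGroup K => ((ψ x : ℂˣ) : ℂ)⁻¹ := h1.inv₀ fun x => (ψ x).ne_zero
    convert h2 using 1
    funext x
    exact Units.val_inv_eq_inv_val _
  let χ : HeckeCharacter K :=
    { toContinuousMonoidHom := ⟨ψ, hψcont⟩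
      map_principal' := by
        rintro _ ⟨u, rfl⟩
        refine Units.ext ?_
        change c (Matrix.GeneralLinearGroup.scalar (Fin 1)
          (Units.map (algebraMap K (AdeleRing (𝓞 K) K) : K →* AdeleRing (𝓞 K) K) u)) = 1
        refine hcK _ ⟨Matrix.GeneralLinearGroup.scalar (Fin 1) u, ?_⟩
        change Matrix.GeneralLinearGroup.map (algebraMap K (AdeleRing (𝓞 K) K))
            (Matrix.GeneralLinearGroup.scalar (Fin 1) u) = _
        rw [Matrix.GeneralLinearGroup.map_scalar] }
  refine ⟨χ, fun g φ hφ => ?_⟩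
  have hχg : ((χ (Matrix.GeneralLinearGroup.det g) : ℂˣ) : ℂ) = c g := by
    change c (Matrix.GeneralLinearGroup.scalar (Fin 1) (Matrix.GeneralLinearGroup.det g)) = c g
    rw [generalLinearGroup_scalar_det_of_fin_one]
  rw [hχg]
  exact hc g φ hφ

/-- **The differential of the Hecke character is the infinitesimal character**: if `χ` is the
Hecke character of `π` (every `g` acts on `W / W'` by `χ(det g)`) and `X ∈ 𝔤𝔩₁(K_∞)` acts on
`W / W'` by `d(X)`, then `χ(det exp(tX)) = e^{t d(X)}`
(`rightTranslation_ofArch_expMem_sub_exp_smul_mem_glOne` and uniqueness of the scalar). Gelbart 1975,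
§2.A; Tate (1950), §2.3 (quasi-characters of `ℝˣ`, `ℂˣ`). [cite: Gelbart1975, §2.A] -/
theorem AutomorphicRepData.heckeCharacter_glOne_det_ofArch_expMem
    (π : AutomorphicRepData (AutomorphyDatum.gl 1 K hcpt)) {χ : HeckeCharacter K}
    (hχ : ∀ (g : (AdelicGroupData.gl 1 K).Adelic), ∀ φ ∈ π.W,
      rightTranslation (AdelicGroupData.gl 1 K) g φ -
        ((χ (Matrix.GeneralLinearGroup.det g) : ℂˣ) : ℂ) • φ ∈ π.W')
    (X : (AutomorphyDatum.gl 1 K hcpt).arch.lie) {dX : ℂ}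
    (hdX : ∀ φ ∈ π.W, lieDeriv (AutomorphyDatum.gl 1 K hcpt).ofArch X φ - dX • φ ∈ π.W') (t : ℝ) :
    ((χ (Matrix.GeneralLinearGroup.det ((AutomorphyDatum.gl 1 K hcpt).ofArch
        ((AutomorphyDatum.gl 1 K hcpt).arch.expMem (t • X)))) : ℂˣ) : ℂ) = Complex.exp (t * dX) :=
  π.sub_smul_mem_unique (hχ _) (fun _ hφ => π.rightTranslation_ofArch_expMem_sub_exp_smul_mem_glOne X hdX t hφ)

/-- **Satake parameters of `π` are values of its Hecke character at uniformizers**: if `χ` is the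
Hecke character of `π` and `α` is a Satake parameter of `π` at `v`, then `α = {χ(⟨ϖ⟩_v)}` for a
uniformizer `ϖ` of `K_v` (the one of the witness: in rank one `T_{v,1} = r(t_{v,1})` on
`K(𝔫)`-fixed forms, `heckeOperator_rightTranslation_glOne`, and `det t_{v,1} = ⟨ϖ⟩_v`,
`det_heckeDiagAt`). Tate (1950), §2.3; Borel–Jacquet 1979, 4.6; Bump §3.3. [cite: BorelJacquet1979, 4.6] -/
theorem AutomorphicRepData.exists_eq_singleton_of_hasSatakeParamAt_glOne
    (π : AutomorphicRepData (AutomorphyDatum.gl 1 K hcpt)) {χ : HeckeCharacter K}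
    (hχ : ∀ (g : (AdelicGroupData.gl 1 K).Adelic), ∀ φ ∈ π.W,
      rightTranslation (AdelicGroupData.gl 1 K) g φ -
        ((χ (Matrix.GeneralLinearGroup.det g) : ℂˣ) : ℂ) • φ ∈ π.W')
    {v : HeightOneSpectrum (𝓞 K)} {α : Multiset ℂ} (hα : π.HasSatakeParamAt v α) :
    ∃ ϖ : (v.adicCompletion K)ˣ, Valued.v (ϖ : v.adicCompletion K) = WithZero.exp (-1 : ℤ) ∧
      α = {((χ (localUnits v ϖ) : ℂˣ) : ℂ)} := by
  obtain ⟨𝔫, ϖ, -, -, hϖ, hcard, φ, hφW, hφW', hfix, hT⟩ := hα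
  refine ⟨ϖ, hϖ, ?_⟩
  obtain ⟨a, rfl⟩ := Multiset.card_eq_one.1 hcard
  have hfix' : IsRightInvariantUnder (principalCongruenceLevel 1 K 𝔫) φ := fun u hu g =>
    congrFun (hfix u hu) g
  have h1 := hT 1 le_rfl
  rw [heckeOperator_rightTranslation_glOne _ _ hfix'] at h1
  have h2 := hχ (heckeDiagAt 1 K v ϖ 1) φ hφW
  rw [det_heckeDiagAt v ϖ le_rfl, pow_one] at h2
  have key := eq_of_sub_smul_mem_of_not_mem h1 h2 hφW'
  simp [Multiset.esymm, Multiset.powersetCard_one] at key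
  rw [key]

/-- **Values at uniformizers are Satake parameters of `π`**: if `χ` is the Hecke character of `π`
and `W ∖ W'` contains a `K(𝔫)`-fixed form (`𝔫 ≠ 0`; such forms exist,
`AutomorphicRepData.exists_principalCongruenceLevel_fixed`), then at every `v ∤ 𝔫` and for every
uniformizer `ϖ` of `K_v`, `{χ(⟨ϖ⟩_v)}` is a Satake parameter of `π` at `v`
(`T_{v,0} = 1`, `T_{v,1} = r(t_{v,1})` acts by `χ(det t_{v,1}) = χ(⟨ϖ⟩_v)`).
Tate (1950), §2.3–2.5; Borel–Jacquet 1979, 4.6; Bump §3.3. [cite: BorelJacquet1979, 4.6] -/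
theorem AutomorphicRepData.hasSatakeParamAt_glOne_of_fixed
    (π : AutomorphicRepData (AutomorphyDatum.gl 1 K hcpt)) {χ : HeckeCharacter K}
    (hχ : ∀ (g : (AdelicGroupData.gl 1 K).Adelic), ∀ φ ∈ π.W,
      rightTranslation (AdelicGroupData.gl 1 K) g φ -
        ((χ (Matrix.GeneralLinearGroup.det g) : ℂˣ) : ℂ) • φ ∈ π.W')
    {𝔫 : Ideal (𝓞 K)} (h𝔫 : 𝔫 ≠ 0) {φ : (AdelicGroupData.gl 1 K).Adelic → ℂ} (hφW : φ ∈ π.W)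
    (hφW' : φ ∉ π.W')
    (hfix : ∀ u ∈ principalCongruenceLevel 1 K 𝔫, rightTranslation (AdelicGroupData.gl 1 K) u φ = φ)
    {v : HeightOneSpectrum (𝓞 K)} (hv : ¬ v.asIdeal ∣ 𝔫) {ϖ : (v.adicCompletion K)ˣ}
    (hϖ : Valued.v (ϖ : v.adicCompletion K) = WithZero.exp (-1 : ℤ)) :
    π.HasSatakeParamAt v {((χ (localUnits v ϖ) : ℂˣ) : ℂ)} := by
  have hfix' : IsRightInvariantUnder (principalCongruenceLevel 1 K 𝔫) φ := fun u hu g =>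
    congrFun (hfix u hu) g
  refine ⟨𝔫, ϖ, h𝔫, hv, hϖ, by simp, φ, hφW, hφW', hfix, fun i hi => ?_⟩
  rw [heckeOperator_rightTranslation_glOne _ _ hfix']
  rcases Nat.le_one_iff_eq_zero_or_eq_one.1 hi with rfl | rfl
  · have h0 : heckeDiagAt 1 K v ϖ 0 = (1 : (AdelicGroupData.gl 1 K).Adelic) :=
      heckeDiagAt_zero (n := 1) (K := K) (v := v) ϖ
    rw [h0, map_one, Module.End.one_apply]
    simp only [Multiset.esymm, Multiset.powersetCard_zero_left, Multiset.map_singleton,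
      Multiset.prod_zero, Multiset.sum_singleton, zero_mul, pow_zero, mul_one, one_smul, sub_self]
    exact π.W'.zero_mem
  · have h2 := hχ (heckeDiagAt 1 K v ϖ 1) φ hφW
    rw [det_heckeDiagAt v ϖ le_rfl, pow_one] at h2
    convert h2 using 2
    simp [Multiset.esymm, Multiset.powersetCard_one]

/-- **Almost everywhere, the Satake parameter of `π` at `v` is `{χ_π(⟨ϖ⟩_v)}` for every uniformizer
`ϖ`** (`exists_principalCongruenceLevel_fixed` and `hasSatakeParamAt_glOne_of_fixed`; the places
dividing the level are finitely many, Mathlib `Ideal.finite_factors`). Borel–Jacquet 1979, 4.6;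
Flath 1979, Thm. 3. [cite: BorelJacquet1979, 4.6] -/
theorem AutomorphicRepData.eventually_hasSatakeParamAt_glOne
    (π : AutomorphicRepData (AutomorphyDatum.gl 1 K hcpt)) {χ : HeckeCharacter K}
    (hχ : ∀ (g : (AdelicGroupData.gl 1 K).Adelic), ∀ φ ∈ π.W,
      rightTranslation (AdelicGroupData.gl 1 K) g φ -
        ((χ (Matrix.GeneralLinearGroup.det g) : ℂˣ) : ℂ) • φ ∈ π.W') :
    ∀ᶠ v : HeightOneSpectrum (𝓞 K) in Filter.cofinite, ∀ ϖ : (v.adicCompletion K)ˣ,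
      Valued.v (ϖ : v.adicCompletion K) = WithZero.exp (-1 : ℤ) →
        π.HasSatakeParamAt v {((χ (localUnits v ϖ) : ℂˣ) : ℂ)} := by
  obtain ⟨𝔫, h𝔫, φ, hφW, hφW', hfix⟩ := π.exists_principalCongruenceLevel_fixed
  have hfin : {v : HeightOneSpectrum (𝓞 K) | v.asIdeal ∣ 𝔫}.Finite := Ideal.finite_factors h𝔫
  have hev : ∀ᶠ v : HeightOneSpectrum (𝓞 K) in Filter.cofinite, ¬ v.asIdeal ∣ 𝔫 := by
    rw [Filter.eventually_cofinite]
    simpa only [not_not] using hfin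
  exact hev.mono fun v hv ϖ hϖ => π.hasSatakeParamAt_glOne_of_fixed hχ h𝔫 hφW hφW' hfix hv hϖ

end GLOneHecke


open Literature.NumberTheory.GaloisRepresentations

section GLOneLift

variable {F E : Type} [Field F] [NumberField F] [Field E] [NumberField E] [Algebra F E]
  {hF : isCompact_glFiniteIntegralLevel 1 F} {hE : isCompact_glFiniteIntegralLevel 1 E}

/-- **Weak base change for `GL₁` read on Hecke characters (Borel–Jacquet model): if `Π` is a
weak base-change lift of `π` then `χ_Π = χ_π ∘ N_{E/F}`.** Here `π = W / W'` and `Π` are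
automorphic representation data on `GL₁(𝔸_F)`, `GL₁(𝔸_E)`, `χ_π`, `χ_Π` their Hecke characters
(`r(g) φ - χ(det g) φ ∈ W'`), and `E/F` is Galois. Arthur–Clozel (1989), Ch. 3 §1, Def. 1.1 and
(1.1) (`t_{Π,w} = t_{π,v}^{f}` a.e.); Cassels–Fröhlich VII Prop. 4.1 (rigidity of Hecke
characters). [cite: ArthurClozelAMS120, Ch. 3, §1 Def. 1.1 and (1.1)] -/
theorem AutomorphicRepData.heckeCharacter_eq_baseChange_of_isWeakBaseChangeLiftAE_glOne [IsGalois F E]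
    {π : AutomorphicRepData (AutomorphyDatum.gl 1 F hF)} {P : AutomorphicRepData (AutomorphyDatum.gl 1 E hE)}
    {χπ : HeckeCharacter F}
    (hχπ : ∀ (g : (AdelicGroupData.gl 1 F).Adelic), ∀ φ ∈ π.W,
      rightTranslation (AdelicGroupData.gl 1 F) g φ -
        ((χπ (Matrix.GeneralLinearGroup.det g) : ℂˣ) : ℂ) • φ ∈ π.W')
    {χP : HeckeCharacter E}
    (hχP : ∀ (g : (AdelicGroupData.gl 1 E).Adelic), ∀ φ ∈ P.W,
      rightTranslation (AdelicGroupData.gl 1 E) g φ -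
        ((χP (Matrix.GeneralLinearGroup.det g) : ℂˣ) : ℂ) • φ ∈ P.W')
    (h : IsWeakBaseChangeLiftAE π P) : χP = χπ.baseChange E := by
  have hπ := π.eventually_hasSatakeParamAt_glOne hχπ
  have h2 : ∀ᶠ w : HeightOneSpectrum (𝓞 E) in cofinite,
      ∀ ϖ : ((w.under (𝓞 F)).adicCompletion F)ˣ,
        Valued.v (ϖ : (w.under (𝓞 F)).adicCompletion F) = WithZero.exp (-1 : ℤ) →
          π.HasSatakeParamAt (w.under (𝓞 F)) {((χπ (localUnits (w.under (𝓞 F)) ϖ) : ℂˣ) : ℂ)} :=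
    (tendsto_under_cofinite (𝓞 F)).eventually hπ
  have hurP : ∀ᶠ w : HeightOneSpectrum (𝓞 E) in cofinite, χP.IsUnramifiedAt w :=
    χP.finite_ramifiedPlaces_iff.1 (HeckeCharacter.finite_ramifiedPlaces_holds _)
  have hurπ : ∀ᶠ w : HeightOneSpectrum (𝓞 E) in cofinite, (χπ.baseChange E).IsUnramifiedAt w :=
    (χπ.baseChange E).finite_ramifiedPlaces_iff.1 (HeckeCharacter.finite_ramifiedPlaces_holds _)
  refine HeckeCharacter.ext_of_eventually_valueAtUniformizer_eq ?_
  filter_upwards [(isWeakBaseChangeLiftAE_iff π P).1 h, h2, eventually_ramificationIdx_eq_one F E,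
    hurP, hurπ] with w hw1 hw2 hw4 huP huπ
  -- `v = w ∩ 𝓞 F`, the uniformizer `ϖ_v` and its image `ϖ'` in `E_w`
  set v := w.under (𝓞 F) with hv
  haveI iw : w.asIdeal.LiesOver v.asIdeal := ⟨rfl⟩
  set ϖ := HeckeCharacter.uniformizer F v with hϖ
  obtain ⟨c, hc, -⟩ := exists_localUnitsAbove E v ϖ
  have he' : v.asIdeal.ramificationIdx' w.asIdeal = 1 := by
    rw [Ideal.ramificationIdx'_eq_ramificationIdx v.asIdeal w.asIdeal v.ne_bot, hw4]
  have heIn : v.asIdeal.ramificationIdxIn (𝓞 E) = 1 := by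
    rw [Ideal.ramificationIdxIn_eq_ramificationIdx v.asIdeal w.asIdeal (E ≃ₐ[F] E), hw4]
  have hfIn : v.asIdeal.inertiaDegIn (𝓞 E) = w.asIdeal.inertiaDeg (𝓞 F) :=
    Ideal.inertiaDegIn_eq_inertiaDeg v.asIdeal w.asIdeal (E ≃ₐ[F] E)
  have hϖ' : Valued.v ((c w : (w.adicCompletion E)ˣ) : w.adicCompletion E) =
      WithZero.exp (-1 : ℤ) := by
    rw [hc w rfl, valued_adicCompletionOfLiesOver, he', pow_one, HeckeCharacter.valued_uniformizer]
  -- (1.1) at `w`: a Satake parameter `{χ_π(ϖ_v)^f}` of `Π`, hence `= {χ_Π(ϖ'')}`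
  have hrel := hw1 v _ rfl (hw2 ϖ (HeckeCharacter.valued_uniformizer v))
  rw [Multiset.map_singleton] at hrel
  obtain ⟨ϖ'', hϖ'', heq⟩ := P.exists_eq_singleton_of_hasSatakeParamAt_glOne hχP hrel
  rw [Multiset.singleton_inj] at heq
  -- compare the two values at the uniformizers `ϖ''`, `ϖ'` of `E_w`
  have hbc : ((χπ.baseChange E (localUnits w (c w)) : ℂˣ) : ℂ) =
      ((χπ (localUnits v ϖ) : ℂˣ) : ℂ) ^ w.asIdeal.inertiaDeg (𝓞 F) := by
    rw [HeckeCharacter.baseChange_localUnits E χπ v ϖ c hc rfl, heIn, one_mul, hfIn,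
      Units.val_pow_eq_pow_val]
  rw [← HeckeCharacter.localComponent_eq_valueAtUniformizer huP hϖ'',
    ← HeckeCharacter.localComponent_eq_valueAtUniformizer huπ hϖ',
    HeckeCharacter.localComponent_apply, HeckeCharacter.localComponent_apply, hbc]
  exact heq.symm

end GLOneLift

end Literature.NumberTheory.Automorphic
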